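import Literature.NumberTheory.EllipticCurves.ZpExtensionGaloisTwistSharpFlatSelmerStructure
import Literature.NumberTheory.EllipticCurves.NeronOggShafarevichLocal
import Literature.NumberTheory.EllipticCurves.Sprung2012.LocalTowerLayersProofs
import Mathlib.GroupTheory.Index
import HarnessLib

/-!
# Route `ByReductionTypeAtTwo` (rung K4), crux `SupersingularRankZeroAtTwo` (item stmt-BirchSwinnertonDyer-19097), line
# `odd_blind_package` (registered v2.6.1, tree v2.8) slot 5, conjunct CDF_glob `OddBlindPackage.FlatBlindControlOfLocalAtTwo`:
# THREE GENERIC LEMMAS behind HT-1 (the local count) — inflation–restriction uniqueness for crossed homomorphisms principal on a normal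
# subgroup, equality of twisted Kummer classes at a completion whose points agree modulo `E(K_∞·K_v) + E[p^∞]`, and `[A : pA] = p^d` for a
# group with no `p`-torsion containing a finite-index `ℤ_p^d` (cell `bsd-2adic`, seat `ss-1` GEN 20, LEAD-held piece of
# `HOME/ss/gen19/HAND-TARGETS-CDFglob.md` §1 step 1; part 1 of 2, part 2 = `…FlatBlindLocalCount.lean`).

HONEST FRAMING: THEOREMS ONLY (no definition, no named fact, no instance, no `sorry`); a helper `--supports 19097`; it proves neither
CDF_glob nor the crux; BSD is proved for no curve by any of this.

## What is proved
* §1 (any topological group, any `TopRep`) `contOneCocycles.apply_eq_of_principalOn_of_normal`: a crossed homomorphism that is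
  PRINCIPAL on a subgroup `S` normalised by `G` with `X^S = 0` is principal with the same vector (uniqueness half of inflation–restriction).
* §2 (any `K` of characteristic `0`, prime `p`, `ℤ_p`-extension `κ`, unit twist `χ_u`, completion `E`; no `p`-torsion in `E(K_∞·K_v)`)
  `pointsMap_twisted_rho_of_mem_localSubgroup` (the twist is invisible on `Gal(K̄_E/(K_∞)_w)`),
  `twisted_eq_zero_of_forall_localSubgroup_rho_eq` (`E[p^J](χ_u)` has no invariants under that subgroup) and
  `oneCocycleClass_eq_of_kummer_congr`: two classes of `H¹(Γ_E, E[p^J](χ_u))` whose cocycles are `τ ↦ τQᵢ − Qᵢ` on `Gal(K̄_E/(K_∞)_w)`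
  with `Q₁ − Q₂ ∈ E(K_∞·K_v) + E[p^∞]` are EQUAL.
* §3 (any abelian group) `index_range_zsmul_eq_pow_of_lattice`: if `A` has no `p`-torsion and contains a finite-index `U ≃+ ℤ_p^d`
  then `[A : pA] = p^d`.

References: [Sprung2012] F. Sprung, J. Number Theory 132 (2012), Def. 7.9 / 7.11 (p. 1503); [GreenbergLNM1716] R. Greenberg, LNM 1716 (1999),
§3 (local inflation–restriction kernels), §4 pp. 107, 122–124; [SerreGaloisCohomology1997] J.-P. Serre, *Galois Cohomology*, I §2.6 (b);
[SilvermanAEC2009] J. Silverman, AEC, III Cor. 6.4 (b), VII Prop. 6.3.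
-/

set_option autoImplicit false
set_option linter.dupNamespace false

noncomputable section

open scoped Classical NumberField

universe u v

namespace Summit.BirchSwinnertonDyer.BirchSwinnertonDyer.Theorems

namespace OddBlindLocal

open NumberField IsDedekindDomain Field WeierstrassCurve Literature.NumberTheory.EllipticCurves
  Literature.NumberTheory.GaloisRepresentations Literature.NumberTheory.GaloisCohomology ZpExtension
  Literature.NumberTheory.EllipticCurves.Kobayashi2003 Literature.NumberTheory.EllipticCurves.Sprung2017
  Literature.NumberTheory.EllipticCurves.Sprung2012 Literature.NumberTheory.EllipticCurves.Rank1Residual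
  CategoryTheory ContinuousCohomology TopRep ContRepresentation

/-! ## §1 Crossed homomorphisms principal on a normal subgroup with no invariants -/

section Cohomology

variable {R : Type u} [Ring R] [TopologicalSpace R]
variable {G : Type v} [Group G] [TopologicalSpace G] [IsTopologicalGroup G]
variable {X : TopRep.{v} R G}

omit [IsTopologicalGroup G] in
/-- **Uniqueness half of inflation–restriction.** If a continuous crossed homomorphism `φ` is PRINCIPAL on a subgroup `S`
normalised by every element of `G` (`φ s = s•v − v` for `s ∈ S`) and `X` has no non-zero `S`-invariant vector, then `φ g = g•v − v`
for EVERY `g` (the defect `φ g − (g•v − v)` is an `S`-invariant vector). [cite: SerreGaloisCohomology1997, Ch. I §2.6 (b)]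
[cite: GreenbergLNM1716, §3 (local inflation–restriction)] -/
theorem contOneCocycles.apply_eq_of_principalOn_of_normal (φ : contOneCocycles X) (S : Subgroup G)
    (hnorm : ∀ g : G, ∀ s ∈ S, g⁻¹ * s * g ∈ S) (hXS : ∀ w : X, (∀ s ∈ S, X.ρ s w = w) → w = 0)
    {v : X} (hv : ∀ s ∈ S, φ.1 s = X.ρ s v - v) (g : G) : φ.1 g = X.ρ g v - v := by
  have key : ∀ s ∈ S, X.ρ s (φ.1 g - (X.ρ g v - v)) = φ.1 g - (X.ρ g v - v) := by
    intro s hs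
    have h1 : s * g = g * (g⁻¹ * s * g) := by simp [mul_assoc]
    have h2 := φ.2 s g
    have h3 := φ.2 g (g⁻¹ * s * g)
    rw [hv s hs] at h2
    rw [hv _ (hnorm g s hs), ← h1, h2] at h3
    have h4 : X.ρ g (X.ρ (g⁻¹ * s * g) v) = X.ρ s (X.ρ g v) := by
      change (X.ρ g * X.ρ (g⁻¹ * s * g)) v = (X.ρ s * X.ρ g) v
      rw [← map_mul, ← map_mul, ← h1]
    rw [map_sub, h4] at h3
    have h5 : X.ρ s (φ.1 g) = φ.1 g + (X.ρ s (X.ρ g v) - X.ρ g v) - (X.ρ s v - v) := by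
      rw [← h3]; abel
    rw [map_sub, map_sub, h5]
    abel
  exact sub_eq_zero.1 (hXS _ key)

end Cohomology

/-! ## §2 Twisted Kummer classes at a completion: equal points modulo `E(K_∞·K_v) + E[p^∞]` give equal classes -/

section Local

variable {K : Type u} [Field K] [CharZero K] (W : WeierstrassCurve K) [W.IsElliptic] (p : ℕ) [hp : Fact p.Prime]
  (κ : ZpExtension K p) (J : ℕ) (u : ℤ) (hu : (p : ℤ) ∣ u - 1)
  (E : Type u) [Field E] [Algebra K E]

omit [CharZero K] [W.IsElliptic] in
/-- On the local subgroup `Gal(K̄_E/(K_∞)_w)` the twisted action on `E[p^J](χ_u)` is the Galois action on points: for `τ` there and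
`m ∈ E[p^J]`, `ι(τ ·_{χ_u} m) = τ • ι(m)` in `E(K̄_E)`. [cite: GreenbergLNM1716, §4 p. 107] -/
theorem pointsMap_twisted_rho_of_mem_localSubgroup {τ : absoluteGaloisGroup E} (hτ : τ ∈ localSubgroup κ.kerSubgroup E)
    (m : ((W.twistedTorsionGaloisModule p κ J u hu).restrictField E).toTopRep) :
    pointsMap W E ((((W.twistedTorsionGaloisModule p κ J u hu).restrictField E).toTopRep.ρ τ m :
        W.geomTorsion ((p ^ J : ℕ) : ℤ)) : W.geomPoints) =
      τ • pointsMap W E ((m : W.geomTorsion ((p ^ J : ℕ) : ℤ)) : W.geomPoints) := by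
  have hτker : resGal (K := K) E τ ∈ κ.kerSubgroup := (mem_localSubgroup_iff κ.kerSubgroup E _).mp hτ
  change pointsMap W E ((W.twistedTorsionGaloisModule p κ J u hu (resGal (K := K) E τ) m :
      W.geomTorsion ((p ^ J : ℕ) : ℤ)) : W.geomPoints) = _
  rw [ZpExtension.galoisTwist_apply_of_mem_kerSubgroup _ _ _ _ _ _ hτker, torsionGaloisModule_apply_apply,
    Literature.NumberTheory.EllipticCurves.AddSubgroup.torsionBy.coe_smul, pointsMap_smul]

omit [CharZero K] [W.IsElliptic] in
/-- `E[p^J](χ_u)` has NO non-zero vector fixed by `Gal(K̄_E/(K_∞)_w)` when `E(K_∞·K_v)` has no `p`-torsion: the point of such a vector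
lies in the tower and is killed by `p^J`. [cite: GreenbergLNM1716, §3 (local kernels), §4 p. 107] -/
theorem twisted_eq_zero_of_forall_localSubgroup_rho_eq
    (hnt : ∀ P ∈ localTowerPointsOfEmb κ (closureEmb (K := K) E) W, p • P = 0 → P = 0)
    (m : ((W.twistedTorsionGaloisModule p κ J u hu).restrictField E).toTopRep)
    (hm : ∀ τ ∈ localSubgroup κ.kerSubgroup E, ((W.twistedTorsionGaloisModule p κ J u hu).restrictField E).toTopRep.ρ τ m = m) :
    m = 0 := by
  have hmem : pointsMap W E ((m : W.geomTorsion ((p ^ J : ℕ) : ℤ)) : W.geomPoints) ∈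
      localTowerPointsOfEmb κ (closureEmb (K := K) E) W := by
    rw [mem_localTowerPointsOfEmb_iff]
    intro τ hτ
    rw [← pointsMap_twisted_rho_of_mem_localSubgroup W p κ J u hu E hτ m, hm τ hτ]
  have hkill : p ^ J • pointsMap W E ((m : W.geomTorsion ((p ^ J : ℕ) : ℤ)) : W.geomPoints) = 0 := by
    rw [← map_nsmul, ← AddSubgroupClass.coe_nsmul, W.pow_nsmul_geomTorsion_pow p J, ZeroMemClass.coe_zero, map_zero]
  have h0 := eq_zero_of_pow_nsmul_eq_zero_of_noPTorsion κ _ W hnt hmem hkill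
  have h1 : ((m : W.geomTorsion ((p ^ J : ℕ) : ℤ)) : W.geomPoints) = 0 :=
    pointsMapOfEmb_injective W (closureEmb (K := K) E) (by rw [map_zero]; exact h0)
  exact Subtype.ext h1

/-- **Equal points modulo `E(K_∞·K_v) + E[p^∞]` give equal classes.** Let `ψ₁, ψ₂` be cocycles of `E[p^J](χ_u)` over `Γ_E` which on
`Gal(K̄_E/(K_∞)_w)` are `τ ↦ τQᵢ − Qᵢ` (read in `E(K̄_E)`), and suppose `Q₁ − Q₂ = e + D` with `e ∈ E(K_∞·K_v)` and `p^N D = 0`.  If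
`E(K_∞·K_v)` has no `p`-torsion then `[ψ₁] = [ψ₂]`: the difference is `τ ↦ τD − D` on the local subgroup, `p^J D` is a tower point
killed by `p^N` hence `0`, so `D = ι(m)` for an `m ∈ E[p^J]` (torsion is algebraic, Silverman III.6.4 (b)); the difference is then
principal on the NORMAL local subgroup, hence principal (§1, no invariants by the previous lemma). [cite: GreenbergLNM1716, §3, §4 pp. 107, 124]
[cite: SerreGaloisCohomology1997, Ch. I §2.6 (b)] [cite: SilvermanAEC2009, Cor. III.6.4 (b)] -/
theorem oneCocycleClass_eq_of_kummer_congr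
    (hnt : ∀ P ∈ localTowerPointsOfEmb κ (closureEmb (K := K) E) W, p • P = 0 → P = 0)
    (ψ₁ ψ₂ : contOneCocycles ((W.twistedTorsionGaloisModule p κ J u hu).restrictField E).toTopRep)
    {Q₁ Q₂ e D : localPoints W E}
    (h₁ : ∀ τ : localSubgroup κ.kerSubgroup E,
      pointsMap W E ((ψ₁.1 (τ : absoluteGaloisGroup E) : W.geomTorsion ((p ^ J : ℕ) : ℤ)) : W.geomPoints) =
        (τ : absoluteGaloisGroup E) • Q₁ - Q₁)
    (h₂ : ∀ τ : localSubgroup κ.kerSubgroup E,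
      pointsMap W E ((ψ₂.1 (τ : absoluteGaloisGroup E) : W.geomTorsion ((p ^ J : ℕ) : ℤ)) : W.geomPoints) =
        (τ : absoluteGaloisGroup E) • Q₂ - Q₂)
    (he : e ∈ localTowerPointsOfEmb κ (closureEmb (K := K) E) W) {N : ℕ} (hD : p ^ N • D = 0) (hQ : Q₁ - Q₂ = e + D) :
    oneCocycleClass _ ψ₁ = oneCocycleClass _ ψ₂ := by
  -- the difference on the local subgroup
  have hφ : ∀ τ : localSubgroup κ.kerSubgroup E,
      pointsMap W E (((ψ₁ - ψ₂).1 (τ : absoluteGaloisGroup E) : W.geomTorsion ((p ^ J : ℕ) : ℤ)) : W.geomPoints) =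
        (τ : absoluteGaloisGroup E) • D - D := by
    intro τ
    have hτe : (τ : absoluteGaloisGroup E) • e = e := (mem_localTowerPointsOfEmb_iff κ _ W e).1 he τ τ.2
    have e3 : (τ : absoluteGaloisGroup E) • Q₁ - Q₁ - ((τ : absoluteGaloisGroup E) • Q₂ - Q₂) =
        (τ : absoluteGaloisGroup E) • (Q₁ - Q₂) - (Q₁ - Q₂) := by rw [smul_sub]; abel
    rw [Submodule.coe_sub, ContinuousMap.sub_apply, AddSubgroupClass.coe_sub, map_sub, h₁ τ, h₂ τ, e3, hQ, smul_add, hτe]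
    abel
  -- `p^J • D = 0`
  have hpJD : p ^ J • D = 0 := by
    have hmem : p ^ J • D ∈ localTowerPointsOfEmb κ (closureEmb (K := K) E) W := by
      rw [mem_localTowerPointsOfEmb_iff]
      intro τ hτ
      have h0 : p ^ J • ((τ • D) - D) = 0 := by
        rw [← hφ ⟨τ, hτ⟩, ← map_nsmul, ← AddSubgroupClass.coe_nsmul, W.pow_nsmul_geomTorsion_pow p J,
          ZeroMemClass.coe_zero, map_zero]
      rwa [smul_sub, sub_eq_zero, smul_comm] at h0
    refine eq_zero_of_pow_nsmul_eq_zero_of_noPTorsion κ _ W hnt hmem (k := N) ?_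
    rw [smul_comm, hD, smul_zero]
  -- lift `D` to `E[p^J]`
  obtain ⟨P, hP0, hPD⟩ := exists_pointsMapOfEmb_eq_of_nsmul_eq_zero (W := W) (closureEmb (K := K) E)
    (m := p ^ J) (pow_ne_zero _ hp.out.ne_zero) hpJD
  have hPmem : P ∈ W.geomTorsion ((p ^ J : ℕ) : ℤ) :=
    (Submodule.mem_torsionBy_iff _ _).mpr (by rw [natCast_zsmul]; exact hP0)
  let m : ((W.twistedTorsionGaloisModule p κ J u hu).restrictField E).toTopRep := ⟨P, hPmem⟩
  have hmD : pointsMap W E ((m : W.geomTorsion ((p ^ J : ℕ) : ℤ)) : W.geomPoints) = D := hPD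
  -- normality of the local subgroup and absence of invariants
  have hN : (localSubgroup κ.kerSubgroup E).Normal := by
    rw [localSubgroup_eq_comap]; exact κ.kerSubgroup_normal.comap _
  have hnorm : ∀ g : absoluteGaloisGroup E, ∀ s ∈ localSubgroup κ.kerSubgroup E, g⁻¹ * s * g ∈ localSubgroup κ.kerSubgroup E :=
    fun g s hs ↦ hN.conj_mem' s hs g
  have hXS := twisted_eq_zero_of_forall_localSubgroup_rho_eq W p κ J u hu E hnt
  -- the difference is principal on the local subgroup with vector `m`
  have hv : ∀ s ∈ localSubgroup κ.kerSubgroup E,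
      (ψ₁ - ψ₂).1 s = ((W.twistedTorsionGaloisModule p κ J u hu).restrictField E).toTopRep.ρ s m - m := by
    intro s hs
    apply Subtype.ext
    apply pointsMapOfEmb_injective W (closureEmb (K := K) E)
    change pointsMap W E _ = pointsMap W E _
    rw [hφ ⟨s, hs⟩, AddSubgroupClass.coe_sub, map_sub, pointsMap_twisted_rho_of_mem_localSubgroup W p κ J u hu E hs m, hmD]
  have hall := contOneCocycles.apply_eq_of_principalOn_of_normal (ψ₁ - ψ₂) (localSubgroup κ.kerSubgroup E) hnorm hXS hv
  have h0 : oneCocycleClass _ (ψ₁ - ψ₂) = 0 := (oneCocycleClass_eq_zero_iff _ _).2 ⟨m, hall⟩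
  rwa [oneCocycleClass_sub, sub_eq_zero] at h0

end Local

/-! ## §3 `[A : pA] = p^d` for a group with no `p`-torsion containing a finite-index `ℤ_p^d` -/

section Lattice

variable {A : Type*} [AddCommGroup A] (p : ℕ) [hp : Fact p.Prime]

/-- **`[A : pA] = p^d`** when `A` has no `p`-torsion and contains a subgroup `U ≃+ ℤ_p^d` of finite index `m`: multiplication by `p`
is injective, so `[A : pU] = [A : U]·[U : pU] = m·p^d` and also `= [A : pA]·[pA : pU] = [A : pA]·m`. [cite: SilvermanAEC2009, VII Prop. 6.3 (use)] -/
theorem index_range_zsmul_eq_pow_of_lattice {d : ℕ} (U : AddSubgroup A) [hU : U.FiniteIndex] (e : U ≃+ (Fin d → ℤ_[p]))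
    (htf : ∀ a : A, p • a = 0 → a = 0) :
    ((zsmulAddGroupHom (p : ℤ) : A →+ A).range).index = p ^ d := by
  set f : A →+ A := zsmulAddGroupHom (p : ℤ) with hf
  have hfapp : ∀ a : A, f a = (p : ℤ) • a := fun _ ↦ rfl
  have hfinj : Function.Injective f := by
    intro a b hab
    have h2 : (p : ℤ) • (a - b) = 0 := by rw [← hfapp, map_sub, hab, sub_self]
    rw [natCast_zsmul] at h2
    exact sub_eq_zero.1 (htf _ h2)
  have h1 : (U.map f).index = U.index * f.range.index := U.index_map_of_injective hfinj
  have hle : U.map f ≤ U := by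
    rintro _ ⟨a, ha, rfl⟩
    rw [hfapp]
    exact U.zsmul_mem ha _
  have h2 : (U.map f).relIndex U * U.index = (U.map f).index := AddSubgroup.relIndex_mul_index hle
  -- `[U : pU] = p^d` through `e` and reduction mod `p` coordinatewise
  let red : (Fin d → ℤ_[p]) →+ (Fin d → ZMod p) := (PadicInt.toZMod (p := p)).toAddMonoidHom.compLeft (Fin d)
  have hred : ∀ x i, red x i = PadicInt.toZMod (x i) := fun _ _ ↦ rfl
  have hredsurj : Function.Surjective red := fun y ↦ by
    choose x hx using fun i ↦ ZMod.ringHom_surjective (PadicInt.toZMod (p := p)) (y i)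
    exact ⟨x, funext fun i ↦ by rw [hred, hx]⟩
  have hredker : ∀ x, x ∈ red.ker ↔ ∀ i, (p : ℤ_[p]) ∣ x i := fun x ↦ by
    rw [AddMonoidHom.mem_ker, funext_iff]
    refine forall_congr' fun i ↦ ?_
    rw [hred, Pi.zero_apply, ← RingHom.mem_ker, PadicInt.ker_toZMod, PadicInt.maximalIdeal_eq_span_p, Ideal.mem_span_singleton]
  have hsub : (U.map f).addSubgroupOf U = red.ker.comap e.toAddMonoidHom := by
    ext x
    rw [AddSubgroup.mem_addSubgroupOf, AddSubgroup.mem_comap, hredker]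
    constructor
    · rintro ⟨a, ha, hax⟩ i
      have hxe : x = (p : ℤ) • (⟨a, ha⟩ : U) := Subtype.ext (by rw [AddSubgroupClass.coe_zsmul]; exact hax.symm)
      refine ⟨e ⟨a, ha⟩ i, ?_⟩
      change e x i = _
      rw [hxe, map_zsmul, Pi.smul_apply, zsmul_eq_mul, Int.cast_natCast]
    · intro h
      choose c hc using h
      refine ⟨(e.symm c : U), (e.symm c).2, ?_⟩
      rw [hfapp, ← AddSubgroupClass.coe_zsmul]
      congr 1
      apply e.injective
      rw [map_zsmul, e.apply_symm_apply]
      funext i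
      rw [Pi.smul_apply, zsmul_eq_mul, Int.cast_natCast]
      exact (hc i).symm
  have h3 : (U.map f).relIndex U = p ^ d := by
    rw [AddSubgroup.relIndex, hsub, AddSubgroup.index_comap_of_surjective _ e.surjective, AddSubgroup.index_ker,
      AddMonoidHom.range_eq_top_of_surjective _ hredsurj, AddSubgroup.card_top, Nat.card_fun, Nat.card_zmod,
      Nat.card_eq_fintype_card, Fintype.card_fin]
  rw [h3, h1] at h2
  have hU0 : 0 < U.index := Nat.pos_of_ne_zero hU.index_ne_zero
  rw [mul_comm] at h2
  exact (Nat.eq_of_mul_eq_mul_left hU0 h2).symm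

end Lattice

end OddBlindLocal

end Summit.BirchSwinnertonDyer.BirchSwinnertonDyer.Theorems

end
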